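import Summits.BirchSwinnertonDyer.BirchSwinnertonDyer.Theorems.ThetaPartnerAtTwoSignedKatoUpToAtTwoColGlue
import Summits.BirchSwinnertonDyer.BirchSwinnertonDyer.Theorems.ThetaPartnerAtTwoSignedKatoUpToAtTwoPointsLocalCover
import Summits.BirchSwinnertonDyer.Rank1Residual.Supersingular.KobayashiMainConjecture
import Literature.NumberTheory.EllipticCurves.Kato2004.EulerSystemBoundFineSelmerTwo
import HarnessLib

/-!
# Route `ThetaPartnerAtTwo` (TP2), crux K3 `SignedKatoDivisibilityUpToAtTwo` (item stmt-BirchSwinnertonDyer-20308),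
# line `colemanrat` v6 — (R2b) `stub_h1SideTwoInv` FROM LAYERWISE LOCAL PAIRINGS: the `𝐇¹`-side of the package read at FINITE level

Width seat `bsd-wall-tp2-p2x-w2` g3 (cell `bsd-wall`). HONEST FRAMING: THEOREMS ONLY — no definition, no named fact, no instance, no
`sorry`; route-independent (no `Theses`/`Cruxes` import — the registered stub text is the CONCLUSION, written out verbatim); closes no
item; the hypothesis carries ALL the research content. BSD is NOT proved by any of this.

## What is proved

`h1SideTwoInv_of_layerPairings` — the registered v6 stub (R2b) `Cruxes.SignedKatoDivisibilityUpToAtTwo.ColemanRat.stub_h1SideTwoInv`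
(lead `bsd-wall-tp2-p2x` g4; skeleton `Lines/colemanrat.lean` v6, sha16 98c9c9a7e9ff1c5b) asks for the TOWER map
`col₀ : 𝐇¹_Γ(T₂E) →+ Hom(E(ℚ_{2,∞}·ℚ_v), ℤ₂)`, `Λ`-compatible for Sprung's `lambdaSMul`, with the raw reciprocity (REC₀) and the explicit
reciprocity law (ERL♭) stated on `col₀`. This file derives it VERBATIM from the same data ONE LEVEL DOWN, where the tree's finite-module
local Tate pairings live: a family of `ℤ₂`-linear LAYER pairings `pair n : H¹(ℚ_n, T₂E) → Hom(E(ℚ_n·ℚ_v), ℤ₂)` with (P1) the projection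
formula `⟨cor x, Q⟩_n = ⟨x, Q⟩_{n+1}` and (P2) Galois invariance `⟨conj_{res g} y, g Q⟩_n = ⟨y, Q⟩_n`, the reciprocity (PT) and the
explicit reciprocity (ERL♭) being stated layerwise («`2^m ⟨proj n x, 2^k Q⟩_n ∈ 2^k ℤ₂` on Kummer witnesses»; «every functional glued from
`⟨proj n s, ·⟩_n` has ♭-Coleman values bounded by `L♭` at `𝔭`»). The glue `col₀`, its `Λ`-compatibility and its uniqueness are
`ColGlue.exists_col_linear` / the layer formula; the passage `col₀ (C(2)^m • x) = 2^m · col₀ x` is `Sprung2012.lambdaSMul_C`. So the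
definition item behind (R2b) may be filed as «the `T₂E`-adic local Tate pairing AT EACH LAYER with (P1), (P2)» — cup product on
`H¹(ℚ_{n,v}, E[2^k])` + Kummer + the tree's local invariant maps, limit in `k` only — with no tower-level construction.

References: [Kato2004Asterisque] §12.2 (p. 220), Thm. 12.5 (p. 222), §17.13 (p. 279); [Kobayashi2003] Thm. 6.3, (7.17)–(7.21), (8.23);
[Sprung2012] Def. 3.1, Def. 5.9, §7; [PerrinRiou1994Invent] §3.6.1; [MilneADT2006] Ch. I Thm. 4.10; [KuriharaOtsuki2006] Lemma 2.1.
-/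

set_option autoImplicit false
-- the Theorems namespace of this sub repeats the summit name by design (D-0017 nested layout)
set_option linter.dupNamespace false

noncomputable section

open scoped Classical MatrixGroups ModularForm NumberField

namespace Summit.BirchSwinnertonDyer.BirchSwinnertonDyer.Theorems

namespace SignedKatoOffTwo.H1SideOfLayerPairings

open CongruenceSubgroup WeierstrassCurve Field IsDedekindDomain NumberField
  Literature.NumberTheory.GaloisRepresentations
  Literature.NumberTheory.EllipticCurves Literature.NumberTheory.EllipticCurves.ModularForms
  Literature.NumberTheory.EllipticCurves.Module Literature.NumberTheory.EllipticCurves.Rank1Residual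
  Literature.NumberTheory.EllipticCurves.Kobayashi2003 Literature.NumberTheory.EllipticCurves.Kato2004
  Literature.NumberTheory.EllipticCurves.Kato2004.EulerSystemValues Literature.NumberTheory.EllipticCurves.GreenbergSelmer
  Literature.NumberTheory.EllipticCurves.Sprung2012
  ZpExtension Summit.BirchSwinnertonDyer.Rank1Residual.Supersingular

/-- **(R2b) `stub_h1SideTwoInv` FROM LAYERWISE LOCAL PAIRINGS.** Per place `v ∋ 2`, habitat datum and height-one `𝔭 ∌ 2`, assume a local
lift `g` (`κ(res g) = 1`), a plus Honda system `d` ((L)(TR)(GEN)(GEN₀), verbatim as in (R2b)), the pinned `I = 𝐇¹_Γ(T₂E)`, `ℤ₂`-linear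
LAYER pairings `pair n : H¹(ℚ_n, T₂E) → Hom(E(ℚ_n·ℚ_v), ℤ₂)` with (P1) projection formula and (P2) invariance for `g`, (PT) orthogonality up
to `2^m` on the Kummer witnesses of the classes of `Sel⁺(E/ℚ_∞)` AT EVERY LAYER containing the point, (ES) a genuine `2`-adic Euler-system
class `s`, and (ERL♭) for every functional `z` glued from `⟨proj n s, ·⟩_n` and every Coleman pair `(Ls, Lf)` of `z` for `(g, d)`:
`ℓ_𝔭(Λ/(Lf)) ≤ ℓ_𝔭(Λ/(L♭))`. THEN (R2b) holds verbatim with `col₀ :=` the glue of the pairings (`ColGlue.exists_col_linear`: additive,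
`col₀ (r • x) = lambdaSMul r (col₀ x)`, `col₀ x|_{E_n} = ⟨proj n x, ·⟩_n`); (REC₀) from (PT) via `col₀ (C(2)^m • x) = 2^m · col₀ x`
(`Sprung2012.lambdaSMul_C`); (ERL♭) by instantiating `z := col₀ s`.
[cite: Kato2004Asterisque, §12.2 (p. 220), Thm. 12.5 (p. 222), §17.13 (p. 279)] [cite: Kobayashi2003, Thm. 6.3 (p. 11), (7.17)–(7.21) (pp. 12–13)]
[cite: Sprung2012, Def. 3.1 (p. 1489), Def. 5.9 (p. 1495)] [cite: PerrinRiou1994Invent, §3.6.1] [cite: MilneADT2006, Ch. I, Thm. 4.10] -/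
theorem h1SideTwoInv_of_layerPairings
    (H :
      ∀ (v : HeightOneSpectrum (𝓞 ℚ)), ((2 : ℕ) : 𝓞 ℚ) ∈ v.asIdeal →
      ∀ (W : WeierstrassCurve ℚ) [W.IsElliptic] [W.IsGloballyMinimal],
        ¬ W.HasCM → W.analyticRank = 0 → GoodSS W 2 → W.frobeniusTrace 2 = 0 →
        ∀ (κ : ZpExtension ℚ 2) (γ : Field.absoluteGaloisGroup ℚ) (hκ : κ.IsCyclotomic),
          κ.IsTopGenerator γ → IsCyclotomicVariable 2 γ →
          ∀ [NeZero (W.conductorNorm ℤ)] (f : CuspForm (Gamma0 (W.conductorNorm ℤ)) 2),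
            IsNewformOf W f → ∀ (ϖ : ℚ), (ϖ : ℝ) * W.realPeriodRat = plusPeriod f →
          ∀ (Lplus Lminus : IwasawaAlgebra 2), IsPollackPair f 2 Lplus Lminus →
          ∀ [ContinuousSMul ℤ_[2] (W.tateModule 2)] [Module.Free ℤ_[2] (W.tateModule 2)]
            [Module.Finite ℤ_[2] (W.tateModule 2)],
          ∀ 𝔭 : PrimeSpectrum (IwasawaAlgebra 2), 𝔭.asIdeal.height = 1 →
            PowerSeries.C (2 : ℤ_[2]) ∉ 𝔭.asIdeal →
          ∃ (g : absoluteGaloisGroup (v.adicCompletion ℚ))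
            (_ : κ.IsTopGenerator (resGalOfEmb (closureEmb (K := ℚ) (v.adicCompletion ℚ)) g))
            (d : ℕ → localPoints W (v.adicCompletion ℚ))
            (I : Kato2004.IwasawaH1Data W 2 κ γ)
            (pair : ∀ n : ℕ, H1 (tateRep W 2) (κ.layerSubgroup n) →ₗ[ℤ_[2]]
              (localLayerPointsOfEmb κ (closureEmb (K := ℚ) (v.adicCompletion ℚ)) W n →+ ℤ_[2]))
            (s : I.H) (m : ℕ),
            -- the plus Honda system at `v`: (L), (TR), (GEN), (GEN₀) (verbatim as in (R2b); HONDA⁺@2 is a tree theorem)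
            (∀ n, d n ∈ localLayerPointsOfEmb κ (closureEmb (K := ℚ) (v.adicCompletion ℚ)) W n) ∧
            (∀ n, localTraceOfEmb κ (closureEmb (K := ℚ) (v.adicCompletion ℚ)) W (n + 1) (n + 2) (d (n + 2)) = -d n) ∧
            (∀ n : ℕ, 1 ≤ n → ∀ P ∈ localLayerPointsOfEmb κ (closureEmb (K := ℚ) (v.adicCompletion ℚ)) W n,
              ∃ B ∈ AddSubgroup.closure (Set.range fun σ : absoluteGaloisGroup (v.adicCompletion ℚ) ↦ σ • d n),
                ∃ P' ∈ localLayerPointsOfEmb κ (closureEmb (K := ℚ) (v.adicCompletion ℚ)) W (n - 1),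
                ∃ R ∈ localLayerPointsOfEmb κ (closureEmb (K := ℚ) (v.adicCompletion ℚ)) W n, P = B + P' + 2 • R) ∧
            (∀ P ∈ localLayerPointsOfEmb κ (closureEmb (K := ℚ) (v.adicCompletion ℚ)) W 0,
              ∃ a : ℤ, ∃ R ∈ localLayerPointsOfEmb κ (closureEmb (K := ℚ) (v.adicCompletion ℚ)) W 0, P = a • d 0 + 2 • R) ∧
            -- (P1) projection formula of the LAYER pairings
            (∀ (n : ℕ) (x : H1 (tateRep W 2) (κ.layerSubgroup (n + 1))) (Q : localPoints W (v.adicCompletion ℚ))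
              (hQ : Q ∈ localLayerPointsOfEmb κ (closureEmb (K := ℚ) (v.adicCompletion ℚ)) W n),
              pair n (layerCores (tateRep W 2) κ n x) ⟨Q, hQ⟩ =
                pair (n + 1) x ⟨Q, localLayerPointsOfEmb_mono κ _ W (Nat.le_succ n) hQ⟩) ∧
            -- (P2) Galois invariance for `g`
            (∀ (n : ℕ) (y : H1 (tateRep W 2) (κ.layerSubgroup n)) (Q : localPoints W (v.adicCompletion ℚ))
              (hQ : Q ∈ localLayerPointsOfEmb κ (closureEmb (K := ℚ) (v.adicCompletion ℚ)) W n),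
              pair n (conjMap (tateRep W 2).toTopRep (κ.layerSubgroup n) (resGalOfEmb (closureEmb (K := ℚ) (v.adicCompletion ℚ)) g) 1 y)
                ⟨g • Q, smul_mem_localLayerPointsOfEmb κ _ W n g hQ⟩ = pair n y ⟨Q, hQ⟩) ∧
            -- (PT) orthogonality up to `2^m` on the Kummer witnesses of `Sel⁺(E/ℚ_∞)` (Poitou–Tate along `ℚ_∞`), per layer
            (∀ (x : I.H) (t : W.subgroupH1 2 κ.kerSubgroup), t ∈ signedSelmerInfty W κ 1 →
              ∀ (φ : contOneCocycles (discreteTopRep κ.kerSubgroup (W.geomPrimaryTorsion 2)))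
                (Q : localPoints W (v.adicCompletion ℚ)) (k : ℕ), oneCocycleClass _ φ = t →
                2 ^ k • Q ∈ (⨆ n, signedLocalPoints κ (v.adicCompletion ℚ) W 1 n) →
                (∀ τ : localSubgroupOfEmb κ.kerSubgroup (closureEmb (K := ℚ) (v.adicCompletion ℚ)),
                  pointsMapOfEmb W (closureEmb (K := ℚ) (v.adicCompletion ℚ))
                      ((φ.1 (resGalSubgroupOfEmb κ.kerSubgroup _ τ) : W.geomPrimaryTorsion 2) : W.geomPoints) =
                    (τ : absoluteGaloisGroup (v.adicCompletion ℚ)) • Q - Q) →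
                ∀ (n : ℕ) (hQn : 2 ^ k • Q ∈ localLayerPointsOfEmb κ (closureEmb (K := ℚ) (v.adicCompletion ℚ)) W n),
                  PadicInt.toZModPow k ((2 : ℤ_[2]) ^ m * pair n (I.proj n x) ⟨2 ^ k • Q, hQn⟩) = 0) ∧
            -- (ES) a genuine `2`-adic Euler-system class
            Kato2004.IsEulerSystemClassTwo W hκ I s ∧
            -- (ERL♭) per layer: every functional glued from `⟨proj n s, ·⟩_n` has its ♭-Coleman values bounded by `L♭` at `𝔭`
            (∀ (z : localTowerPointsOfEmb κ (closureEmb (K := ℚ) (v.adicCompletion ℚ)) W →+ ℤ_[2]),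
              (∀ (n : ℕ) (Q : localPoints W (v.adicCompletion ℚ)) (hQ : Q ∈ localLayerPointsOfEmb κ (closureEmb (K := ℚ) (v.adicCompletion ℚ)) W n),
                z ⟨Q, localLayerPointsOfEmb_le_localTowerPointsOfEmb κ _ W n hQ⟩ = pair n (I.proj n s) ⟨Q, hQ⟩) →
              ∀ Ls Lf : IwasawaAlgebra 2, IsColemanPair κ (closureEmb (K := ℚ) (v.adicCompletion ℚ)) W 0 g d z Ls Lf →
                lengthAt (IwasawaAlgebra 2) (IwasawaAlgebra 2 ⧸ Ideal.span {Lf}) 𝔭 ≤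
                  lengthAt (IwasawaAlgebra 2) (IwasawaAlgebra 2 ⧸ Ideal.span {kobayashiL 1 Lplus Lminus}) 𝔭)) :
    -- the registered v6 stub (R2b) `Cruxes.SignedKatoDivisibilityUpToAtTwo.ColemanRat.stub_h1SideTwoInv`, verbatim
    ∀ (v : HeightOneSpectrum (𝓞 ℚ)), ((2 : ℕ) : 𝓞 ℚ) ∈ v.asIdeal →
    ∀ (W : WeierstrassCurve ℚ) [W.IsElliptic] [W.IsGloballyMinimal],
      ¬ W.HasCM → W.analyticRank = 0 → GoodSS W 2 → W.frobeniusTrace 2 = 0 →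
      ∀ (κ : ZpExtension ℚ 2) (γ : Field.absoluteGaloisGroup ℚ) (hκ : κ.IsCyclotomic),
        κ.IsTopGenerator γ → IsCyclotomicVariable 2 γ →
        ∀ [NeZero (W.conductorNorm ℤ)] (f : CuspForm (Gamma0 (W.conductorNorm ℤ)) 2),
          IsNewformOf W f → ∀ (ϖ : ℚ), (ϖ : ℝ) * W.realPeriodRat = plusPeriod f →
        ∀ (Lplus Lminus : IwasawaAlgebra 2), IsPollackPair f 2 Lplus Lminus →
        ∀ [ContinuousSMul ℤ_[2] (W.tateModule 2)] [Module.Free ℤ_[2] (W.tateModule 2)]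
          [Module.Finite ℤ_[2] (W.tateModule 2)],
        ∀ 𝔭 : PrimeSpectrum (IwasawaAlgebra 2), 𝔭.asIdeal.height = 1 →
          PowerSeries.C (2 : ℤ_[2]) ∉ 𝔭.asIdeal →
        ∃ (g : absoluteGaloisGroup (v.adicCompletion ℚ))
          (hg : κ.IsTopGenerator (resGalOfEmb (closureEmb (K := ℚ) (v.adicCompletion ℚ)) g))
          (d : ℕ → localPoints W (v.adicCompletion ℚ))
          (I : Kato2004.IwasawaH1Data W 2 κ γ)
          (col₀ : I.H →+ (localTowerPointsOfEmb κ (closureEmb (K := ℚ) (v.adicCompletion ℚ)) W →+ ℤ_[2]))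
          (s : I.H) (m : ℕ),
          (∀ n, d n ∈ localLayerPointsOfEmb κ (closureEmb (K := ℚ) (v.adicCompletion ℚ)) W n) ∧
          (∀ n, localTraceOfEmb κ (closureEmb (K := ℚ) (v.adicCompletion ℚ)) W (n + 1) (n + 2) (d (n + 2)) = -d n) ∧
          (∀ n : ℕ, 1 ≤ n → ∀ P ∈ localLayerPointsOfEmb κ (closureEmb (K := ℚ) (v.adicCompletion ℚ)) W n,
            ∃ B ∈ AddSubgroup.closure (Set.range fun σ : absoluteGaloisGroup (v.adicCompletion ℚ) ↦ σ • d n),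
              ∃ P' ∈ localLayerPointsOfEmb κ (closureEmb (K := ℚ) (v.adicCompletion ℚ)) W (n - 1),
              ∃ R ∈ localLayerPointsOfEmb κ (closureEmb (K := ℚ) (v.adicCompletion ℚ)) W n, P = B + P' + 2 • R) ∧
          (∀ P ∈ localLayerPointsOfEmb κ (closureEmb (K := ℚ) (v.adicCompletion ℚ)) W 0,
            ∃ a : ℤ, ∃ R ∈ localLayerPointsOfEmb κ (closureEmb (K := ℚ) (v.adicCompletion ℚ)) W 0, P = a • d 0 + 2 • R) ∧
          (∀ (r : IwasawaAlgebra 2) (x : I.H),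
            col₀ (r • x) = lambdaSMul κ (closureEmb (K := ℚ) (v.adicCompletion ℚ)) W hg r (col₀ x)) ∧
          (∀ (x : I.H) (t : W.subgroupH1 2 κ.kerSubgroup), t ∈ signedSelmerInfty W κ 1 →
            ∀ (φ : contOneCocycles (discreteTopRep κ.kerSubgroup (W.geomPrimaryTorsion 2)))
              (Q : localPoints W (v.adicCompletion ℚ)) (k : ℕ), oneCocycleClass _ φ = t →
            ∀ hQ : 2 ^ k • Q ∈ (⨆ n, signedLocalPoints κ (v.adicCompletion ℚ) W 1 n),
            (∀ τ : localSubgroupOfEmb κ.kerSubgroup (closureEmb (K := ℚ) (v.adicCompletion ℚ)),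
              pointsMapOfEmb W (closureEmb (K := ℚ) (v.adicCompletion ℚ))
                  ((φ.1 (resGalSubgroupOfEmb κ.kerSubgroup _ τ) : W.geomPrimaryTorsion 2) : W.geomPoints) =
                (τ : absoluteGaloisGroup (v.adicCompletion ℚ)) • Q - Q) →
            (PadicInt.toZModPow k
                (col₀ ((PowerSeries.C (2 : ℤ_[2]) : IwasawaAlgebra 2) ^ m • x)
                  ⟨2 ^ k • Q, KummerPoint.iSup_signedLocalPoints_le_localTowerPointsOfEmb W 2 κ 1 v hQ⟩)).val •
              ((((2 : ℚ) ^ k)⁻¹ : ℚ) : AddCircle (1 : ℚ)) = 0) ∧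
          Kato2004.IsEulerSystemClassTwo W hκ I s ∧
          (∀ Ls Lf : IwasawaAlgebra 2,
            IsColemanPair κ (closureEmb (K := ℚ) (v.adicCompletion ℚ)) W 0 g d (col₀ s) Ls Lf →
            lengthAt (IwasawaAlgebra 2) (IwasawaAlgebra 2 ⧸ Ideal.span {Lf}) 𝔭 ≤
              lengthAt (IwasawaAlgebra 2) (IwasawaAlgebra 2 ⧸ Ideal.span {kobayashiL 1 Lplus Lminus}) 𝔭) := by
  intro v hv W _ _ hcm hr hss ha κ γ hκ hγ hcv _ f hf ϖ hϖ Lplus Lminus hPP _ _ _ 𝔭 h𝔭 hp𝔭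
  obtain ⟨g, hg, d, I, pair, s, m, hd, htr, hgen, hgen0, hP1, hP2, hPT, hES, hERL⟩ :=
    H v hv W hcm hr hss ha κ γ hκ hγ hcv f hf ϖ hϖ Lplus Lminus hPP 𝔭 h𝔭 hp𝔭
  -- the glued, `Λ`-compatible `col₀`
  obtain ⟨col₀, hcol₀, hlayer⟩ := ColGlue.exists_col_linear I _ pair hγ hg hP1 hP2
  refine ⟨g, hg, d, I, col₀, s, m, hd, htr, hgen, hgen0, hcol₀, fun x t ht φ Q k hφ hQ hτ ↦ ?_, hES, fun Ls Lf hCP ↦ ?_⟩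
  · -- (REC₀) from (PT): `col₀ (C(2)^m • x) (2^k Q) = 2^m · ⟨proj n x, 2^k Q⟩_n`
    obtain ⟨n, hn⟩ := exists_mem_localLayerPointsOfEmb_of_mem_localTowerPointsOfEmb κ _ W
      (KummerPoint.iSup_signedLocalPoints_le_localTowerPointsOfEmb W 2 κ 1 v hQ)
    have hval : col₀ ((PowerSeries.C (2 : ℤ_[2]) : IwasawaAlgebra 2) ^ m • x)
        ⟨2 ^ k • Q, KummerPoint.iSup_signedLocalPoints_le_localTowerPointsOfEmb W 2 κ 1 v hQ⟩ =
        (2 : ℤ_[2]) ^ m * pair n (I.proj n x) ⟨2 ^ k • Q, hn⟩ := by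
      rw [hcol₀, ← map_pow, lambdaSMul_C, AddMonoidHom.smul_apply, smul_eq_mul]
      congr 1
      exact hlayer n x (2 ^ k • Q) hn
    rw [hval, hPT x t ht φ Q k hφ hQ hτ n hn, ZMod.val_zero, zero_smul]
  · -- (ERL♭) for `z := col₀ s`
    exact hERL (col₀ s) (fun n Q hQ ↦ hlayer n s Q hQ) Ls Lf hCP

end SignedKatoOffTwo.H1SideOfLayerPairings

end Summit.BirchSwinnertonDyer.BirchSwinnertonDyer.Theorems

end
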